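import Mathlib

/-!
# Crux `WordLengthQP` (stmt-ValiantsHypothesis-6623), line `positive-monoid-exits` —
stub `stub_adjacentNormalForm`: the adjacent normal form of a real elementary word

A real letter is `(i, j, c, v) : Fin 3 × Fin 3 × ℝ × Option σ` with matrix the transvection
`E_ij(c)` (`v = none`) or `E_ij(c·x_v)` (`v = some v`) over `MvPolynomial σ ℝ`; a word is a list of
letters, its value the product of the letter matrices; an EXIT is a letter that is not
(positive coefficient and adjacent, `|i - j| = 1`).

**Adjacent normal form.** Every valid word (all letters off-diagonal, `i ≠ j`) has an equivalent
word (same product) all of whose letters are adjacent with nonzero coefficient, with at most twice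
as many exits and at most four times the length.  Construction, letter by letter:

* a zero letter `E_ij(0) = 1` is deleted (`Matrix.transvection_zero`);
* an adjacent nonzero letter is kept;
* a far letter is a Steinberg commutator of adjacent letters,
  `E₀₂(a) = E₀₁(a) E₁₂(1) E₀₁(-a) E₁₂(-1)` and `E₂₀(a) = E₂₁(-1) E₁₀(-a) E₂₁(1) E₁₀(a)`;
  each right-hand side has exactly two non-positive letters whatever the sign of the (nonzero)
  coefficient, while the far letter itself was one exit.

The bookkeeping (product of blocks, exits and length are additive under concatenation) is the
generic list lemma `normalForm_aux`; the per-letter construction is `exists_block`.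

References: [BenOrCleve1992] Thm 1 (the commutator of elementary matrices); the Steinberg
relation `[E_ij(a), E_jk(b)] = E_ik(ab)` in `E₃(R)` is folklore.
-/

-- `Summit.ValiantsHypothesis.ValiantsHypothesis.…` is the tree's mandated single-conjunct layout
-- (Sub = Summit), so the duplicated namespace component is intended.
set_option linter.dupNamespace false

noncomputable section

namespace Summit.ValiantsHypothesis.ValiantsHypothesis.Cruxes.WordLengthQP.PositiveMonoidExits

/-! ## The two Steinberg commutators (right-associated, as `List.prod` produces them) -/

/-- `E₀₂(a) = E₀₁(a) (E₁₂(1) (E₀₁(-a) E₁₂(-1)))` in `E₃` over any commutative ring: the Steinberg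
relation `[E₀₁(a), E₁₂(1)] = E₀₂(a)`. [folklore] -/
private theorem far02_eq_commutator' {R : Type} [CommRing R] (a : R) :
    Matrix.transvection (0 : Fin 3) 1 a * (Matrix.transvection (1 : Fin 3) 2 1 *
      (Matrix.transvection (0 : Fin 3) 1 (-a) * Matrix.transvection (1 : Fin 3) 2 (-1))) =
    Matrix.transvection (0 : Fin 3) 2 a := by
  ext i j
  fin_cases i <;> fin_cases j <;>
    simp [Matrix.transvection, Matrix.mul_apply, Fin.sum_univ_three, Matrix.single,
      Matrix.of_apply, Matrix.one_apply]

/-- `E₂₀(a) = E₂₁(-1) (E₁₀(-a) (E₂₁(1) E₁₀(a)))` in `E₃` over any commutative ring: the Steinberg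
relation `[E₂₁(-1), E₁₀(-a)] = E₂₀(a)`. [folklore] -/
private theorem far20_eq_commutator' {R : Type} [CommRing R] (a : R) :
    Matrix.transvection (2 : Fin 3) 1 (-1) * (Matrix.transvection (1 : Fin 3) 0 (-a) *
      (Matrix.transvection (2 : Fin 3) 1 1 * Matrix.transvection (1 : Fin 3) 0 a)) =
    Matrix.transvection (2 : Fin 3) 0 a := by
  ext i j
  fin_cases i <;> fin_cases j <;>
    simp [Matrix.transvection, Matrix.mul_apply, Fin.sum_univ_three, Matrix.single,
      Matrix.of_apply, Matrix.one_apply]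

/-! ## Generic bookkeeping: blockwise replacement of letters -/

/-- Blockwise replacement: if every letter `l` of `w` (satisfying `V`) can be replaced by a block
`b` of `Q`-letters with the same product, at most twice the `p`-count of `[l]` and length `≤ 4`,
then `w` can be replaced by a word of `Q`-letters with the same product, at most twice the
`p`-count and at most four times the length (concatenate the blocks). [folklore] -/
private theorem normalForm_aux {α M : Type*} [Monoid M] (f : α → M) (p : α → Bool)
    (V Q : α → Prop)
    (hstep : ∀ l, V l → ∃ b : List α, (∀ x ∈ b, Q x) ∧ (b.map f).prod = f l ∧
      (b.filter p).length ≤ 2 * (([l] : List α).filter p).length ∧ b.length ≤ 4)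
    (w : List α) (hw : ∀ l ∈ w, V l) :
    ∃ w' : List α, (∀ x ∈ w', Q x) ∧ (w'.map f).prod = (w.map f).prod ∧
      (w'.filter p).length ≤ 2 * (w.filter p).length ∧ w'.length ≤ 4 * w.length := by
  induction w with
  | nil => exact ⟨[], by simp, rfl, by simp, by simp⟩
  | cons l w ih =>
    obtain ⟨b, hbQ, hbprod, hbfilt, hblen⟩ := hstep l (hw l (by simp))
    obtain ⟨w', hQ, hprod, hfilt, hlen⟩ := ih (fun x hx => hw x (by simp [hx]))
    refine ⟨b ++ w', ?_, ?_, ?_, ?_⟩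
    · intro x hx
      rcases List.mem_append.1 hx with hx | hx
      exacts [hbQ x hx, hQ x hx]
    · rw [List.map_append, List.prod_append, hbprod, hprod, List.map_cons, List.prod_cons]
    · have e : (l :: w).filter p = ([l] : List α).filter p ++ w.filter p := by
        rw [← List.filter_append]; rfl
      rw [List.filter_append, List.length_append, e, List.length_append]
      omega
    · rw [List.length_append, List.length_cons]
      omega

/-! ## The per-letter construction -/

/-- Off-diagonal, non-adjacent positions in `Fin 3 × Fin 3` are `(0, 2)` and `(2, 0)`. [folklore] -/
private theorem far_cases : ∀ i j : Fin 3, i ≠ j → ¬ (i.val + 1 = j.val ∨ j.val + 1 = i.val) →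
    (i = 0 ∧ j = 2) ∨ (i = 2 ∧ j = 0) := by
  decide

/-- The block replacing ONE valid letter `l = (i, j, c, v)`: `[]` if `c = 0` (`E_ij(0) = 1`), `[l]`
if `l` is adjacent, and the four adjacent letters of the Steinberg commutator if `l` is far
(`(0,2)` or `(2,0)`); the block consists of adjacent nonzero letters, has the same product, at most
twice the exits of `[l]`, and length `≤ 4`. [cite: BenOrCleve1992, Thm 1] -/
private theorem exists_block {σ : Type} (l : Fin 3 × Fin 3 × ℝ × Option σ) (hl : l.1 ≠ l.2.1) :
    ∃ b : List (Fin 3 × Fin 3 × ℝ × Option σ),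
      (∀ x ∈ b, (x.1.val + 1 = x.2.1.val ∨ x.2.1.val + 1 = x.1.val) ∧ x.2.2.1 ≠ 0) ∧
      (b.map (fun l => Matrix.transvection l.1 l.2.1
        (MvPolynomial.C l.2.2.1 * l.2.2.2.elim 1 MvPolynomial.X))).prod =
        Matrix.transvection l.1 l.2.1 (MvPolynomial.C l.2.2.1 * l.2.2.2.elim 1 MvPolynomial.X) ∧
      (b.filter (fun l => !decide (0 < l.2.2.1 ∧
          (l.1.val + 1 = l.2.1.val ∨ l.2.1.val + 1 = l.1.val)))).length ≤
        2 * (([l] : List (Fin 3 × Fin 3 × ℝ × Option σ)).filter (fun l => !decide (0 < l.2.2.1 ∧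
          (l.1.val + 1 = l.2.1.val ∨ l.2.1.val + 1 = l.1.val)))).length ∧
      b.length ≤ 4 := by
  obtain ⟨i, j, c, v⟩ := l
  simp only at hl
  by_cases hc : c = 0
  · -- a zero letter is the identity matrix: delete it
    subst hc
    refine ⟨[], by simp, ?_, by simp, by simp⟩
    simp [Matrix.transvection_zero]
  by_cases hadj : i.val + 1 = j.val ∨ j.val + 1 = i.val
  · -- an adjacent nonzero letter is kept
    refine ⟨[(i, j, c, v)], ?_, by simp, le_mul_of_one_le_left (Nat.zero_le _) (by norm_num),
      by simp⟩
    intro x hx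
    rw [List.mem_singleton] at hx
    subst hx
    exact ⟨hadj, hc⟩
  -- a far letter is a Steinberg commutator of four adjacent letters
  rcases far_cases i j hl hadj with ⟨rfl, rfl⟩ | ⟨rfl, rfl⟩
  · refine ⟨[(0, 1, c, v), (1, 2, 1, none), (0, 1, -c, v), (1, 2, -1, none)], ?_, ?_, ?_, by simp⟩
    · intro x hx
      simp only [List.mem_cons, List.mem_nil_iff, or_false] at hx
      rcases hx with rfl | rfl | rfl | rfl <;> simp [hc]
    · simpa [map_neg, neg_mul] using
        far02_eq_commutator' (MvPolynomial.C c * v.elim 1 MvPolynomial.X : MvPolynomial σ ℝ)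
    · rcases lt_or_gt_of_ne hc with hneg | hpos
      · simp [hneg, not_lt.mpr hneg.le]
      · simp [hpos, not_lt.mpr hpos.le]
  · refine ⟨[(2, 1, -1, none), (1, 0, -c, v), (2, 1, 1, none), (1, 0, c, v)], ?_, ?_, ?_, by simp⟩
    · intro x hx
      simp only [List.mem_cons, List.mem_nil_iff, or_false] at hx
      rcases hx with rfl | rfl | rfl | rfl <;> simp [hc]
    · simpa [map_neg, neg_mul] using
        far20_eq_commutator' (MvPolynomial.C c * v.elim 1 MvPolynomial.X : MvPolynomial σ ℝ)
    · rcases lt_or_gt_of_ne hc with hneg | hpos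
      · simp [hneg, not_lt.mpr hneg.le]
      · simp [hpos, not_lt.mpr hpos.le]

/-! ## The registered stub -/

/-- **Adjacent normal form** (crux `WordLengthQP`, line `positive-monoid-exits`, stub
`stub_adjacentNormalForm`): every valid real word (letters `(i, j, c, v)` with `i ≠ j`) can be
replaced by a word with the SAME product all of whose letters are adjacent (`|i - j| = 1`) with
nonzero coefficient, at most doubling the number of exits (letters that are not positive-adjacent)
and at most quadrupling the length: delete zero letters (`Matrix.transvection_zero`) and rewrite far
letters as Steinberg commutators of adjacent ones, `E₀₂(a) = E₀₁(a)E₁₂(1)E₀₁(-a)E₁₂(-1)` and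
`E₂₀(a) = E₂₁(-1)E₁₀(-a)E₂₁(1)E₁₀(a)` (`a = c` or `c·x_v`; each right-hand side has exactly two
non-positive letters). [cite: BenOrCleve1992, Thm 1] -/
theorem stub_adjacentNormalForm {σ : Type} (w : List (Fin 3 × Fin 3 × ℝ × Option σ))
    (hw : ∀ l ∈ w, l.1 ≠ l.2.1) :
    ∃ w' : List (Fin 3 × Fin 3 × ℝ × Option σ),
      (∀ l ∈ w', (l.1.val + 1 = l.2.1.val ∨ l.2.1.val + 1 = l.1.val) ∧ l.2.2.1 ≠ 0) ∧
      (w'.map (fun l => Matrix.transvection l.1 l.2.1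
        (MvPolynomial.C l.2.2.1 * l.2.2.2.elim 1 MvPolynomial.X))).prod =
      (w.map (fun l => Matrix.transvection l.1 l.2.1
        (MvPolynomial.C l.2.2.1 * l.2.2.2.elim 1 MvPolynomial.X))).prod ∧
      (w'.filter (fun l => !decide (0 < l.2.2.1 ∧
          (l.1.val + 1 = l.2.1.val ∨ l.2.1.val + 1 = l.1.val)))).length ≤
        2 * (w.filter (fun l => !decide (0 < l.2.2.1 ∧
          (l.1.val + 1 = l.2.1.val ∨ l.2.1.val + 1 = l.1.val)))).length ∧
      w'.length ≤ 4 * w.length :=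
  normalForm_aux
    (fun l : Fin 3 × Fin 3 × ℝ × Option σ => Matrix.transvection l.1 l.2.1
      (MvPolynomial.C l.2.2.1 * l.2.2.2.elim 1 MvPolynomial.X))
    (fun l => !decide (0 < l.2.2.1 ∧ (l.1.val + 1 = l.2.1.val ∨ l.2.1.val + 1 = l.1.val)))
    (fun l => l.1 ≠ l.2.1)
    (fun l => (l.1.val + 1 = l.2.1.val ∨ l.2.1.val + 1 = l.1.val) ∧ l.2.2.1 ≠ 0)
    exists_block w hw

end Summit.ValiantsHypothesis.ValiantsHypothesis.Cruxes.WordLengthQP.PositiveMonoidExits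

end
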